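import Literature.MeasureTheory.Hausdorff.SelfSimilarCode
import HarnessLib

/-!
# Self-similar Cantor dusts: words, generations and the disjointness of the pieces

Support file (all results proved, no definitions) for the barrier
`Literature.Barriers.NavierStokesRegularity.NavierStokesInequalityNearlyOneDimSingularSet`
(Scheffer 1987), complementing the accepted `SelfSimilarCode`: elementary combinatorics of the
composite similarities `Γ_m = Γ_{m_0} ∘ ⋯ ∘ Γ_{m_{j-1}}` (`CantorDust.word`) of an iterated
function system `Γ_n(x) = τ x + d_n` with a common ratio, as used in Ożański's rendering of
Scheffer's construction (arXiv:1709.00602, §6.1–§6.2):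

* `CantorDust.word_snoc`, `CantorDust.word_eq_word_init` — peeling off the INNERMOST letter,
  `Γ_{(m̄, n)} = Γ_{m̄} ∘ Γ_n` (Ożański: "`x = Γ_{m̄}(Γ_{m_j}(y))`", p. 29);
* `CantorDust.image_word_subset` — `Γ_m(G) ⊆ Γ_{m_0}(G)` for an invariant `G`;
* `CantorDust.disjoint_image_word` — **distinct words of equal length have disjoint pieces**,
  `Γ_m(G) ∩ Γ_{m'}(G) = ∅` for `m ≠ m'`, `|m| = |m'|`, when the first-generation pieces
  `Γ_n(G)` are pairwise disjoint and `G` is invariant (Ożański 2017, §6.1: "The above inclusion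
  and (6.3) give that `Γ_m(G) ∩ Γ_{m̃}(G) = ∅` for `m, m̃ ∈ M(j)`, `m ≠ m̃`");
* `CantorDust.mem_level_iff`, `CantorDust.isCompact_level`, `CantorDust.isClosed_level`,
  `CantorDust.level_succ_subset` — the generations `⋃_{|m|=j} Γ_m(G)` are compact and decrease.

## References

* W. S. Ożański, arXiv:1709.00602v4 (2017/2019), §6.1 (the multi-indices `M(j)`, `π_m`, `Γ_m`,
  the disjointness and monotonicity of `⋃_{m∈M(j)} Γ_m(G)`). [`Ozanski2017NSISingular`]
* V. Scheffer, Comm. Math. Phys. 110 (1987), 525–551, (5.19)–(5.25). [`Scheffer1987`]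
-/

noncomputable section

open Set Function

namespace Literature.MeasureTheory.Hausdorff

namespace CantorDust

variable {E : Type*} [NormedAddCommGroup E] [NormedSpace ℝ E]
variable {τ : ℝ} {M : ℕ} {d : Fin M → E} {G : Set E}

/-! ### Peeling off the innermost letter -/

/-- `Γ_{(m, n)} = Γ_m ∘ Γ_n`: appending a letter at the END of a word composes with `Γ_n` on the
INSIDE (Ożański 2017, §6.1: `Γ_m(G) = Γ_{m̄}(Γ_{m_j}(G))`). [cite: Ozanski2017NSISingular, §6.1] -/
theorem word_snoc {j : ℕ} (m : Fin j → Fin M) (n : Fin M) (x : E) :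
    word τ d (Fin.snoc m n : Fin (j + 1) → Fin M) x = word τ d m (τ • x + d n) := by
  simp only [word, Fin.sum_univ_castSucc, Fin.snoc_castSucc, Fin.snoc_last, Fin.val_castSucc,
    Fin.val_last, smul_add, smul_smul, pow_succ]
  abel

/-- A word of positive length is its initial segment followed by `Γ` of its last letter:
`Γ_m(x) = Γ_{init m}(τ x + d_{m_last})`. [cite: Ozanski2017NSISingular, §6.1] -/
theorem word_eq_word_init {j : ℕ} (m : Fin (j + 1) → Fin M) (x : E) :
    word τ d m x = word τ d (Fin.init m) (τ • x + d (m (Fin.last j))) := by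
  conv_lhs => rw [← Fin.snoc_init_self m]
  exact word_snoc _ _ _

/-- A word of positive length is `Γ` of its first letter applied to the word of its tail:
`Γ_m(x) = τ Γ_{tail m}(x) + d_{m_0}`. [folklore] -/
theorem word_eq_word_tail {j : ℕ} (m : Fin (j + 1) → Fin M) (x : E) :
    word τ d m x = τ • word τ d (Fin.tail m) x + d (m 0) := by
  conv_lhs => rw [← Fin.cons_self_tail m]
  exact word_cons _ _ _

/-! ### Pieces of distinct words are disjoint -/

/-- For an invariant `G`, the piece of a nonempty word lies in the first-generation piece of
its first letter: `Γ_m(G) ⊆ Γ_{m_0}(G)`. [cite: Ozanski2017NSISingular, §6.1] -/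
theorem image_word_subset (hG : ∀ n, MapsTo (fun x => τ • x + d n) G G) {j : ℕ}
    (m : Fin (j + 1) → Fin M) :
    word τ d m '' G ⊆ (fun x => τ • x + d (m 0)) '' G := by
  rintro _ ⟨x, hx, rfl⟩
  exact ⟨word τ d (Fin.tail m) x, mapsTo_word hG j _ hx, (word_eq_word_tail m x).symm⟩

/-- **Distinct words of the same length have disjoint pieces.** If `G` is invariant under every
`Γ_n` and the first-generation pieces `Γ_n(G)` are pairwise disjoint, then
`Γ_m(G) ∩ Γ_{m'}(G) = ∅` for all words `m ≠ m'` of equal length (`τ ≠ 0`) (Ożański 2017,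
§6.1: "`Γ_m(G) ∩ Γ_{m̃}(G) = ∅` for `m, m̃ ∈ M(j)`, `j ≥ 1`, with `m ≠ m̃`").
[cite: Ozanski2017NSISingular, §6.1] -/
theorem disjoint_image_word (hτ : τ ≠ 0) (hG : ∀ n, MapsTo (fun x => τ • x + d n) G G)
    (hd : Pairwise fun n n' =>
      Disjoint ((fun x => τ • x + d n) '' G) ((fun x => τ • x + d n') '' G)) :
    ∀ {j : ℕ} {m m' : Fin j → Fin M}, m ≠ m' → Disjoint (word τ d m '' G) (word τ d m' '' G)
  | 0, m, m', hne => absurd (Subsingleton.elim m m') hne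
  | j + 1, m, m', hne => by
      by_cases h0 : m 0 = m' 0
      · -- same first letter: the tails differ, and `Γ_{m_0}` is injective
        have htail : Fin.tail m ≠ Fin.tail m' := fun h => hne <| by
          rw [← Fin.cons_self_tail m, ← Fin.cons_self_tail m', h0, h]
        have ih := disjoint_image_word hτ hG hd htail
        have hinj : Injective fun x : E => τ • x + d (m 0) :=
          fun x y hxy => smul_right_injective E hτ (add_right_cancel hxy)
        have e : ∀ m'' : Fin (j + 1) → Fin M, word τ d m'' '' G =
            (fun x : E => τ • x + d (m'' 0)) '' (word τ d (Fin.tail m'') '' G) := fun m'' => by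
          rw [image_image]
          exact image_congr fun x _ => word_eq_word_tail m'' x
        rw [e m, e m', ← h0]
        exact (disjoint_image_iff hinj).2 ih
      · exact (hd h0).mono (image_word_subset hG m) (image_word_subset hG m')

/-- A point common to two pieces of the same generation determines the word (contrapositive
form of `disjoint_image_word`). [cite: Ozanski2017NSISingular, §6.1] -/
theorem eq_of_word_eq_word (hτ : τ ≠ 0) (hG : ∀ n, MapsTo (fun x => τ • x + d n) G G)
    (hd : Pairwise fun n n' =>
      Disjoint ((fun x => τ • x + d n) '' G) ((fun x => τ • x + d n') '' G))
    {j : ℕ} {m m' : Fin j → Fin M} {x y : E} (hx : x ∈ G) (hy : y ∈ G)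
    (h : word τ d m x = word τ d m' y) : m = m' := by
  by_contra hne
  exact Set.disjoint_left.1 (disjoint_image_word hτ hG hd hne) (mem_image_of_mem _ hx)
    (h ▸ mem_image_of_mem _ hy)

/-! ### The generations -/

/-- Membership in the `j`-th generation. [folklore] -/
theorem mem_level_iff {j : ℕ} {x : E} :
    x ∈ level τ d G j ↔ ∃ (m : Fin j → Fin M) (y : E), y ∈ G ∧ word τ d m y = x := by
  simp only [level, mem_iUnion, mem_image]

/-- The composite similarities are continuous. [folklore] -/
theorem continuous_word {j : ℕ} (m : Fin j → Fin M) : Continuous (word τ d m) :=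
  (continuous_const_smul _).add continuous_const

/-- The generations of a compact set are compact (finite unions of continuous images).
[folklore] -/
theorem isCompact_level (hG : IsCompact G) (j : ℕ) : IsCompact (level τ d G j) :=
  isCompact_iUnion fun m => hG.image (continuous_word m)

/-- The generations of a compact set are closed. [folklore] -/
theorem isClosed_level [T2Space E] (hG : IsCompact G) (j : ℕ) : IsClosed (level τ d G j) :=
  (isCompact_level hG j).isClosed

/-- The zeroth generation is `G` itself. [folklore] -/
theorem level_zero : level τ d G 0 = G := by
  ext x
  simp only [mem_level_iff, word_zero, exists_eq_right]
  exact ⟨fun ⟨_, h⟩ => h, fun h => ⟨Fin.elim0, h⟩⟩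

/-- **The generations decrease** for an invariant `G`: `⋃_{|m|=j+1} Γ_m(G) ⊆ ⋃_{|m|=j} Γ_m(G)`
(Ożański 2017, §6.1: "the family of sets `⋃_{m∈M(j)} Γ_m(G)` decreases as `j` increases").
[cite: Ozanski2017NSISingular, §6.1] -/
theorem level_succ_subset (hG : ∀ n, MapsTo (fun x => τ • x + d n) G G) (j : ℕ) :
    level τ d G (j + 1) ⊆ level τ d G j := by
  intro x hx
  obtain ⟨m, y, hy, rfl⟩ := mem_level_iff.1 hx
  exact mem_level_iff.2 ⟨Fin.init m, τ • y + d (m (Fin.last j)), hG _ hy,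
    (word_eq_word_init m y).symm⟩

/-- The generations decrease (monotone form). [cite: Ozanski2017NSISingular, §6.1] -/
theorem level_antitone (hG : ∀ n, MapsTo (fun x => τ • x + d n) G G) :
    Antitone (level τ d G) :=
  antitone_nat_of_succ_le fun j => level_succ_subset hG j

end CantorDust

end Literature.MeasureTheory.Hausdorff

end
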